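import Mathlib

/-!
# Killing free products costs rank: codimension ≥ induced matching number (ROUND-24 item T24.8c, the rank half of the gap lemma)

FRONTIER range-avoidance ladder, rung F-N3, ROUND 24 (cell `pnp-ideate`; free-standing linear algebra for the rank route of the
gap lemma `PstarGapLemma.PstarGapLemmaSO` — nothing here bears on `P` versus `NP`).

**Setting (any field `K`).**  A multigraph on the vertex type `ι` is an edge list `j ↦ {p j, q j}` over a finite index set
`J : Finset κ`; its PRODUCT SUM is the quadratic function `qform J p q a = Σ_{j ∈ J} a (p j) · a (q j)` on `ι → K` and its polar
form is the bilinear form `polar J p q v w = Σ_{j ∈ J} (v (p j) · w (q j) + v (q j) · w (p j))` (the adjacency form of the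
multigraph): `qform (v + w) = qform v + qform w + polar v w` (`qform_add`).

**Theorem (`finrank_add_card_le`).**  If `qform J p q` is constant on an affine subspace `v₀ + V` then for every INDUCED MATCHING
`M ⊆ J` (pairwise vertex-disjoint non-loop edges such that no other edge of `J` has both endpoints among their vertices):
`finrank V + |M| ≤ |ι|`, i.e. the codimension of `V` is at least the induced matching number of the graph.  Proof (polarisation):
constancy gives `qform v = −polar v₀ v` on `V`, whence `polar v w = 0` for `v, w ∈ V` (`polar_eq_zero_of_const`: `V` is totally
isotropic, `V ≤ V^⊥`); the general identity `finrank V + finrank V^⊥ = |ι| + finrank (V ⊓ ker polar)`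
(`LinearMap.BilinForm.finrank_add_finrank_orthogonal'`) then bounds `2·finrank V ≤ |ι| + finrank (ker polar)`; and the kernel
meets the span of the `2|M|` coordinate vectors of the matched vertices trivially (`polar v e_{q j} = v (p j)` for `v` supported
there, `polar_single_q`), so `finrank (ker polar) ≤ |ι| − 2|M|`.

**Corollary (`finrank_le_of_const_pairs`, the planner's T24.8c as stated).**  For `g` disjoint products `a_{2i} a_{2i+1}` on
`Fin (2g) → K`: constancy on `v₀ + V` forces `finrank V ≤ g` (isotropic subspaces of a rank-`2g` alternating form).

The sequel `PstarInducedMatching` supplies the greedy induced matching of a simple graph of maximum degree `Δ`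
(`|J| ≤ 2Δ²·|M|`), giving `|J| ≤ 2Δ² · codim V` — the one-dense-parity case of the gap lemma.
-/

set_option linter.dupNamespace false -- `Summit.PneNP.PneNP.…`: summit = sub-problem name (D-0017 single-conjunct layout)

open Finset Module

namespace Summit.PneNP.PneNP.Theorems.PstarProductRank

variable {K : Type*} [Field K] {ι κ : Type*}

/-! ## The product sum and its polar form -/

/-- The product sum of the edge list `j ↦ {p j, q j}` over `J`: `Σ_{j ∈ J} a (p j) · a (q j)`. -/
def qform (J : Finset κ) (p q : κ → ι) (a : ι → K) : K := ∑ j ∈ J, a (p j) * a (q j)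

/-- The polar (adjacency) bilinear form of the edge list: `Σ_{j ∈ J} (v (p j) · w (q j) + v (q j) · w (p j))`. -/
def polar (J : Finset κ) (p q : κ → ι) : LinearMap.BilinForm K (ι → K) :=
  LinearMap.mk₂ K (fun v w => ∑ j ∈ J, (v (p j) * w (q j) + v (q j) * w (p j)))
    (fun v v' w => by
      rw [← sum_add_distrib]
      exact sum_congr rfl fun _ _ => by simp only [Pi.add_apply]; ring)
    (fun c v w => by
      rw [smul_eq_mul, mul_sum]
      exact sum_congr rfl fun _ _ => by simp only [Pi.smul_apply, smul_eq_mul]; ring)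
    (fun v w w' => by
      rw [← sum_add_distrib]
      exact sum_congr rfl fun _ _ => by simp only [Pi.add_apply]; ring)
    (fun c v w => by
      rw [smul_eq_mul, mul_sum]
      exact sum_congr rfl fun _ _ => by simp only [Pi.smul_apply, smul_eq_mul]; ring)

/-- Pointwise form of the polar form. -/
@[simp] theorem polar_apply (J : Finset κ) (p q : κ → ι) (v w : ι → K) :
    polar J p q v w = ∑ j ∈ J, (v (p j) * w (q j) + v (q j) * w (p j)) := rfl

/-- **Polarisation identity**: `Q(v + w) = Q(v) + Q(w) + B(v, w)`. -/
theorem qform_add (J : Finset κ) (p q : κ → ι) (v w : ι → K) :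
    qform J p q (v + w) = qform J p q v + qform J p q w + polar J p q v w := by
  simp only [qform, polar_apply, Pi.add_apply, ← sum_add_distrib]
  exact sum_congr rfl fun _ _ => by ring

/-- **Constancy on an affine subspace makes the direction totally isotropic.**  If `Q` is constant on `v₀ + V` then
`B(v, w) = 0` for all `v, w ∈ V`. -/
theorem polar_eq_zero_of_const {J : Finset κ} {p q : κ → ι} {V : Submodule K (ι → K)} {v₀ : ι → K}
    (h : ∀ v ∈ V, qform J p q (v₀ + v) = qform J p q v₀) {v w : ι → K} (hv : v ∈ V) (hw : w ∈ V) :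
    polar J p q v w = 0 := by
  have key : ∀ u ∈ V, qform J p q u = -polar J p q v₀ u := by
    intro u hu
    have e := h u hu
    rw [qform_add] at e
    linear_combination e
  have e := qform_add J p q v w
  rw [key _ (V.add_mem hv hw), key _ hv, key _ hw, map_add] at e
  linear_combination -e

section Cover

variable [DecidableEq ι]

/-- The polar form against a coordinate vector `e_c`: the `J`-edges at `c`, read at their other endpoint. -/
theorem polar_single (J : Finset κ) (p q : κ → ι) (v : ι → K) (c : ι) :
    polar J p q v (Pi.single c 1) =
      ∑ j ∈ J.filter (fun j => q j = c), v (p j) + ∑ j ∈ J.filter (fun j => p j = c), v (q j) := by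
  rw [polar_apply, sum_add_distrib, sum_filter, sum_filter]
  congr 1 <;> exact sum_congr rfl fun j _ => by simp only [Pi.single_apply]; split_ifs <;> simp

/-! ## Induced matchings -/

/-- The vertices covered by the edges of `M`. -/
def cover (M : Finset κ) (p q : κ → ι) : Finset ι := M.biUnion fun j => {p j, q j}

/-- Membership in the cover. -/
theorem mem_cover {M : Finset κ} {p q : κ → ι} {c : ι} : c ∈ cover M p q ↔ ∃ j ∈ M, c = p j ∨ c = q j := by
  simp [cover]

/-- `M` is an INDUCED MATCHING of the multigraph `J`: a set of non-loop edges of `J`, pairwise vertex-disjoint, such that every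
edge of `J` with both endpoints covered by `M` belongs to `M`. -/
structure IsInducedMatching (J M : Finset κ) (p q : κ → ι) : Prop where
  /-- `M ⊆ J` -/
  subset : M ⊆ J
  /-- no loops -/
  loopless : ∀ j ∈ M, p j ≠ q j
  /-- pairwise vertex-disjoint -/
  disjoint : ∀ j ∈ M, ∀ j' ∈ M, j ≠ j' → p j ≠ p j' ∧ p j ≠ q j' ∧ q j ≠ p j' ∧ q j ≠ q j'
  /-- induced: an edge of `J` inside the cover is an edge of `M` -/
  induced : ∀ j' ∈ J, p j' ∈ cover M p q → q j' ∈ cover M p q → j' ∈ M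

namespace IsInducedMatching

variable {J M : Finset κ} {p q : κ → ι}

/-- The cover of a matching has exactly `2|M|` vertices. -/
theorem card_cover (hM : IsInducedMatching J M p q) : (cover M p q).card = 2 * M.card := by
  unfold cover
  rw [card_biUnion]
  · rw [sum_const_nat (m := 2) fun j hj => card_pair (hM.loopless j hj)]
    ring
  · intro j hj j' hj' hne
    obtain ⟨h1, h2, h3, h4⟩ := hM.disjoint j hj j' hj' hne
    simp only [Function.onFun, disjoint_insert_right, mem_insert, mem_singleton, disjoint_singleton_right, not_or]
    exact ⟨⟨fun e => h1 e.symm, fun e => h3 e.symm⟩, fun e => h2 e.symm, fun e => h4 e.symm⟩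

/-- Against `e_{q j}` (`j ∈ M`), a vector supported on the cover has polar value `v (p j)`: the only `J`-edge at `q j` whose other
endpoint is covered is `j` itself. -/
theorem polar_single_q (hM : IsInducedMatching J M p q) {j : κ} (hj : j ∈ M) {v : ι → K}
    (hv : ∀ c, c ∉ cover M p q → v c = 0) : polar J p q v (Pi.single (q j) 1) = v (p j) := by
  classical
  rw [polar_single]
  have hqc : q j ∈ cover M p q := mem_cover.2 ⟨j, hj, Or.inr rfl⟩
  have h1 : ∑ j' ∈ J.filter (fun j' => q j' = q j), v (p j') = v (p j) := by
    rw [sum_eq_single_of_mem j]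
    · exact mem_filter.2 ⟨hM.subset hj, rfl⟩
    intro j' hj' hne
    obtain ⟨hj'J, hqq⟩ := mem_filter.1 hj'
    apply hv
    intro hp
    have hj'M : j' ∈ M := hM.induced j' hj'J hp (hqq ▸ hqc)
    exact (hM.disjoint j hj j' hj'M (Ne.symm hne)).2.2.2 hqq.symm
  have h2 : ∑ j' ∈ J.filter (fun j' => p j' = q j), v (q j') = 0 := by
    refine sum_eq_zero fun j' hj' => ?_
    obtain ⟨hj'J, hpq⟩ := mem_filter.1 hj'
    apply hv
    intro hq
    have hj'M : j' ∈ M := hM.induced j' hj'J (hpq ▸ hqc) hq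
    by_cases hne : j = j'
    · subst hne; exact hM.loopless j hj hpq
    · exact (hM.disjoint j hj j' hj'M hne).2.2.1 hpq.symm
  rw [h1, h2, add_zero]

/-- Against `e_{p j}` (`j ∈ M`), a vector supported on the cover has polar value `v (q j)`. -/
theorem polar_single_p (hM : IsInducedMatching J M p q) {j : κ} (hj : j ∈ M) {v : ι → K}
    (hv : ∀ c, c ∉ cover M p q → v c = 0) : polar J p q v (Pi.single (p j) 1) = v (q j) := by
  classical
  rw [polar_single]
  have hpc : p j ∈ cover M p q := mem_cover.2 ⟨j, hj, Or.inl rfl⟩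
  have h1 : ∑ j' ∈ J.filter (fun j' => q j' = p j), v (p j') = 0 := by
    refine sum_eq_zero fun j' hj' => ?_
    obtain ⟨hj'J, hqp⟩ := mem_filter.1 hj'
    apply hv
    intro hp
    have hj'M : j' ∈ M := hM.induced j' hj'J hp (hqp ▸ hpc)
    by_cases hne : j = j'
    · subst hne; exact hM.loopless j hj hqp.symm
    · exact (hM.disjoint j hj j' hj'M hne).2.1 hqp.symm
  have h2 : ∑ j' ∈ J.filter (fun j' => p j' = p j), v (q j') = v (q j) := by
    rw [sum_eq_single_of_mem j]
    · exact mem_filter.2 ⟨hM.subset hj, rfl⟩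
    intro j' hj' hne
    obtain ⟨hj'J, hpp⟩ := mem_filter.1 hj'
    apply hv
    intro hq
    have hj'M : j' ∈ M := hM.induced j' hj'J (hpp ▸ hpc) hq
    exact (hM.disjoint j hj j' hj'M (Ne.symm hne)).1 hpp.symm
  rw [h1, h2, zero_add]

/-- The span of the coordinate vectors of the covered vertices. -/
theorem apply_eq_zero_of_mem_span {C : Finset ι} {v : ι → K}
    (hv : v ∈ Submodule.span K (Set.range fun c : C => Pi.single (c : ι) (1 : K))) (c : ι) (hc : c ∉ C) : v c = 0 := by
  induction hv using Submodule.span_induction with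
  | mem x hx =>
    obtain ⟨⟨c', hc'⟩, rfl⟩ := hx
    have hne : c ≠ c' := fun h => hc (h ▸ hc')
    exact Pi.single_eq_of_ne hne _
  | zero => rfl
  | add x y _ _ hx hy => simp [hx, hy]
  | smul a x _ hx => simp [hx]

/-- **The kernel of the polar form misses the coordinate span of the cover of an induced matching.** -/
theorem ker_inf_span_eq_bot (hM : IsInducedMatching J M p q) :
    LinearMap.ker (polar (K := K) J p q) ⊓
      Submodule.span K (Set.range fun c : cover M p q => Pi.single (c : ι) (1 : K)) = ⊥ := by
  rw [Submodule.eq_bot_iff]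
  intro v hv
  obtain ⟨hvk, hvS⟩ := Submodule.mem_inf.1 hv
  have hsupp : ∀ c, c ∉ cover M p q → v c = 0 := apply_eq_zero_of_mem_span hvS
  have hzero : ∀ w, polar J p q v w = 0 := fun w => by
    rw [LinearMap.mem_ker] at hvk
    rw [hvk, LinearMap.zero_apply]
  funext c
  by_cases hc : c ∈ cover M p q
  · obtain ⟨j, hj, hcj⟩ := mem_cover.1 hc
    rcases hcj with rfl | rfl
    · rw [← hM.polar_single_q hj hsupp]; exact hzero _
    · rw [← hM.polar_single_p hj hsupp]; exact hzero _
  · exact hsupp c hc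

/-- **Codimension ≥ induced matching number.**  If the product sum of `J` is constant on the affine subspace `v₀ + V` then
`finrank V + |M| ≤ |ι|` for every induced matching `M` of `J`. -/
theorem finrank_add_card_le [Fintype ι] (hM : IsInducedMatching J M p q) {V : Submodule K (ι → K)} {v₀ : ι → K}
    (h : ∀ v ∈ V, qform J p q (v₀ + v) = qform J p q v₀) : finrank K V + M.card ≤ Fintype.card ι := by
  set B : LinearMap.BilinForm K (ι → K) := polar J p q with hB
  -- `V` is totally isotropic
  have hVorth : V ≤ B.orthogonal V := by
    intro w hw
    rw [LinearMap.BilinForm.mem_orthogonal_iff]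
    intro v hv
    exact polar_eq_zero_of_const h hv hw
  have h1 : finrank K V ≤ finrank K (B.orthogonal V) := Submodule.finrank_mono hVorth
  have h2 := LinearMap.BilinForm.finrank_add_finrank_orthogonal' (B := B) V
  -- the coordinate span of the cover
  set S : Submodule K (ι → K) := Submodule.span K (Set.range fun c : cover M p q => Pi.single (c : ι) (1 : K)) with hS
  have hScard : finrank K S = (cover M p q).card := by
    rw [hS, finrank_span_eq_card, Fintype.card_coe]
    exact (Pi.linearIndependent_single_one ι K).comp _ Subtype.val_injective
  have hker : LinearMap.ker B ⊓ S = ⊥ := hM.ker_inf_span_eq_bot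
  have h3 : finrank K (LinearMap.ker B) + finrank K S ≤ finrank K (ι → K) := by
    have e := Submodule.finrank_sup_add_finrank_inf_eq (LinearMap.ker B) S
    rw [hker, finrank_bot, add_zero] at e
    rw [← e]
    exact Submodule.finrank_le _
  have h4 : finrank K ↥(V ⊓ LinearMap.ker B) ≤ finrank K (LinearMap.ker B) := Submodule.finrank_mono inf_le_right
  have hcov : (cover M p q).card = 2 * M.card := hM.card_cover
  have hN : finrank K (ι → K) = Fintype.card ι := Module.finrank_pi K
  omega

end IsInducedMatching

end Cover

/-! ## The planner's form: `g` disjoint products on `2g` coordinates -/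

/-- Left factor index `2i`. -/
def pairL (g : ℕ) (i : Fin g) : Fin (2 * g) := ⟨2 * i.val, by have := i.isLt; omega⟩

/-- Right factor index `2i + 1`. -/
def pairR (g : ℕ) (i : Fin g) : Fin (2 * g) := ⟨2 * i.val + 1, by have := i.isLt; omega⟩

/-- The `g` disjoint pairs form an induced matching of themselves. -/
theorem isInducedMatching_pairs (g : ℕ) : IsInducedMatching (univ : Finset (Fin g)) univ (pairL g) (pairR g) where
  subset := Subset.rfl
  loopless j _ := by simp [pairL, pairR, Fin.ext_iff]
  disjoint j _ j' _ hne := by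
    have : j.val ≠ j'.val := fun h => hne (Fin.ext h)
    simp only [pairL, pairR, ne_eq, Fin.mk.injEq]
    omega
  induced j' _ _ _ := mem_univ _

/-- **T24.8c (planner's statement).**  If `Q(a) = Σ_{i<g} a_{2i} a_{2i+1}` is constant on the affine subspace `v₀ + V` of
`Fin (2g) → K` then `finrank V ≤ g`: a totally isotropic subspace of the rank-`2g` alternating form has dimension `≤ g`. -/
theorem finrank_le_of_const_pairs (g : ℕ) {V : Submodule K (Fin (2 * g) → K)} {v₀ : Fin (2 * g) → K}
    (h : ∀ v ∈ V, qform univ (pairL g) (pairR g) (v₀ + v) = qform univ (pairL g) (pairR g) v₀) :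
    finrank K V ≤ g := by
  have := (isInducedMatching_pairs g).finrank_add_card_le (K := K) h
  simp only [card_univ, Fintype.card_fin] at this
  omega

end Summit.PneNP.PneNP.Theorems.PstarProductRank
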